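import Literature.AnabelianGeometry.EtaleTheta.Discharge.Sec5Thm56OfBiKummerData
import Literature.AnabelianGeometry.EtaleTheta.Discharge.Sec5Prop55GaloisLeafOfBiKummerData
import Literature.AnabelianGeometry.EtaleTheta.Discharge.Sec5Prop55SgpCupConjOfBiKummerData
import Literature.AnabelianGeometry.EtaleTheta.Discharge.Sec5UnitsFixedByGeometricOfCnst
import Literature.AnabelianGeometry.EtaleTheta.Discharge.Sec5StrvTransportOfBiKummerData
import Literature.AnabelianGeometry.EtaleTheta.Discharge.Sec5TransportsOfBiKummerData
import Literature.AnabelianGeometry.EtaleTheta.Discharge.Sec5OfBiKummerDataKummer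
import Literature.AnabelianGeometry.EtaleTheta.Discharge.Sec5Prop55OfLawsOfBiKummerData

/-!
# [EtTh] Prop. 5.5 ⊕ Thm. 5.6 at the GENUINE §5 data — ALL LANDED LEAVES PLUGGED BY NAME (PDF pp. 101–103 = printed 327–329)

Mochizuki, *The étale theta function and its Frobenioid-theoretic manifestations*, Publ. RIMS **45** (2009)
[cite: MochizukiEtTh2009, Prop 5.5 p.327 (PDF p.101); Thm 5.6 p.328 (PDF p.102)].  abc-iut cell, layer L2, row «P55-A ⊕ T56-A
CONSOLIDATION v2» (abc-iut-L2-lead ROWS #13-addendum R113; seat abc-iut-w5-d020 gen 3, K4 holder of plan/L2/SUBDAG-EtTh-Thm56.md).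
PROOF-ONLY (no definitions, no new named fact).  One node-closer for the cone nodes `EtTh:Prop5.5` + `EtTh:Thm5.6(i)` at
abc-iut-L2-t4's assembled §5 data `𝔉 := ThetaFrobenioid.ofBiKummerData …` (W3-L2-01), whose hypothesis list is the UNION of the
print-level residuals of the pool's leaf files — the (C2) layer-certificate entry for these two nodes.

Base: abc-iut-w5-d123's composition `exists_rigidityFamily_unique_preserved_ofBiKummerData` (p427275: «Ψ preserves THE unique
functorial Kummer-determined family», Prop 5.5 AT THE DATA ⊕ Thm 5.6 AT THE DATA, `hdiff` by abc-iut-L2-t4's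
`biKummerDifferenceMem_ofBiKummerData`).  Leaves plugged here, each replacing a binder by its printed input:
* P55-L06 `hind` ⟶ (G) `hGalT` «a Galois object is an `Aut`-torsor over every target» (abc-iut-w4-d099
  `linearBaseTorsor_ofBiKummerData_of_galoisHomTorsor`, p425506; [SemiAnbd] Rmk 3.1.3, PROVED at `B^temp(Π)⁰` p424508) +
  `hproj` (named: law on the free pair `(Q, P)`, abc-iut-w4-d042's MERGE-PLAN row 2 companions) + P55-L06c `hcup` ⟶ `hKR`
  «Galois-equivariance of the bi-Kummer root» (abc-iut-L6-t23 `hcup_iff_pull_root_mul`, p425515; [EtTh] Prop 1.3 p.329);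
* T56-L09b `hconst` ⟶ Prop 3.4 (ii) `Prop34Cnst` + the origin clause `hΔcnst` (abc-iut-w5-d020 `hconst_ofBiKummerData_of_cnst`,
  p425781; `hΔcnst` itself is PROVED at the constructed constant-field functor of [FrdII] Ex 1.3 (ii) by abc-iut-w5-d118,
  p427220 `pushforward_map_conjAut_galoisSurjOf_eq_id`, connected-temperoid base);
* the transports `eA, Dp, hT, hT′, hu, hstrv` ⟶ the NORMALISED Thm 5.7 transport `(α, β)` (`D_c = 1`, `e = 1`: abc-iut-L2-d4's
  `exists_codTransport_of_div_eq` + abc-iut-w5-d245's `capCupTransport_normalise`, with Prop 5.3 (vi) absorbed into `α`) + the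
  section-pair / Frobenius-transport data of [FrdI] Prop 5.6 / Thm 3.4 (iii) (abc-iut-w5-d245 `exists_unit_strvTransport_ofBiKummerData`,
  p427158), via the UNIT RENORMALISATION of this file: the Prop 5.6 unit `u ∈ O^×(A_N)` is moved across the root to
  `u′ ∈ O^×(B_N)` (`(s^⊓_N)^* u′ = u`; `(s^⊓_N)^*` is onto since `Base(s^⊓_N)` is an isomorphism, [FrdI] Thm 5.2 (ii)), so `β`
  changes to `β ≫ u′` WITHOUT changing its base arrow — hence without touching the `Δ`-transport binder `haΨ` (T56-L09c);
* `hYdd` ⟶ Prop 2.4 `hP24` (abc-iut-w5-d245 `hYdd_ofBiKummerData_of_prop24`, p424854).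
Residual binders (all NAMED, each a printed input or an interface law recorded on plan/GAP-LEDGER.md): the (η, ν) pin of Prop 5.2 (iii)
(`hη₀`, `hdies` [G-L6t23-1, G-L6t23-2], `e`, `he`, `hpre`, `hP`, `hcov′` [G-w5d123-2], `hKν`), `hσ` ([FrdI] Prop 5.6), `hgeom` [MERGE-PLAN
row 2], `Prop34Cnst`, `hΔcnst` [G-w5d020-2], `hreach` (abc-iut-L2-t4 `LinearlyReachableFromBN`, F-w5d123-3 flag: stronger than
print — the print-faithful currency is `Thm56Sub.CyclotomicRigidityCod`, p424534/p427514), `hLc`/`hLi` (free stub `Q`), `hH`/`hfrac`/`haut`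
(t4's `hdiff` inputs), `hGalT`, `hproj` [G-w4d099-2], `hKR` [G-L6t23-3], the Ψ-side data of abc-iut-L2-d4 (`Ψbs, eΨ, aΨ, hlin, haΨn,
hpull`), the normalised transport (`α, β, Dp₀, hc₁, hp₁, hDp₀`), the [FrdI] Prop 5.6 / Thm 3.4 (iii) data at `A_N`
(`φ, hφ, hc, θ, hθ, ΨN, hdeg, hbi, hft`), Prop 2.4 (`γ, hγ, hγL, hP24`) and T56-L09c (`haΨ`).
HONEST FRAMING: kernel-checked implications between typed statements about the assembled §5 data; the binder `P :
ThetaSubquotientProj 𝔉` is a HYPOTHESIS (abc-iut-w5-d029's inhabitation criterion governs its non-vacuity at a genuine base);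
nothing asserts that such data exist for an actual curve; typed ≠ discharged; no side taken on [IUTchIII] Cor. 3.12.
-/

noncomputable section

/-! ### [FrdI] Thm. 5.2 (ii): along a morphism with ISOMORPHIC base the unit pull-back is onto -/

namespace Literature.AlgebraicGeometry.Frobenioids

namespace ModelFrobenioid

open CategoryTheory Opposite

universe w' v'' u''

variable {D : Type u''} [Category.{v''} D] {Φ B : Dᵒᵖ ⥤ CommMonCat.{w'}} {DivB : B ⟶ monoidGp Φ}

/-- **`φ^* : O^×(Y) → O^×(X)` is onto when `Base(φ)` is an isomorphism** (the components of `φ^* τ` are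
`(Φ(Base φ)(Div τ), B(Base φ)(u_τ))`, [FrdI] Thm. 5.2 (ii); push forward along `Base(φ)⁻¹`).  Used for the pre-step `s^⊓_N`
([EtTh] §5 p.331 (PDF p.105)).  [cite: MochizukiFrdI2008, Thm. 5.2(ii) p.101] -/
theorem unitsPull_surjective_of_isIso_baseMap {X Y : ModelFrobenioid Φ B DivB} (φ : X ⟶ Y) [IsIso (baseMap φ)] :
    Function.Surjective (unitsPull φ) := by
  intro τ
  refine ⟨⟨unitAut Y ((Φ.map (inv (baseMap φ)).op).hom (div τ.1.hom)) ((Φ.map (inv (baseMap φ)).op).hom (div τ.1.inv))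
      ((B.map (inv (baseMap φ)).op).hom (unit τ.1.hom)) ((B.map (inv (baseMap φ)).op).hom (unit τ.1.inv))
      (of_map_eq_divB_map _ (of_div_eq_divB_unit_of_mem_units τ.2))
      (of_map_eq_divB_map _ (of_div_eq_divB_unit_of_mem_units ((units X).inv_mem τ.2)))
      (by rw [← map_mul, (div_inv_mul_div_of_mem_units τ.2).1, map_one])
      (by rw [← map_mul, (div_inv_mul_div_of_mem_units τ.2).2, map_one]),
    unitAut_mem_units _ _ _ _ _ _ _ _ _⟩, ?_⟩
  have hΦ : ∀ x : Φ.obj (op X.base), (Φ.map (baseMap φ).op).hom ((Φ.map (inv (baseMap φ)).op).hom x) = x := by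
    intro x
    rw [← MonoidHom.comp_apply, ← CommMonCat.hom_comp, ← Φ.map_comp, ← op_comp, IsIso.hom_inv_id, op_id, Φ.map_id,
      CommMonCat.hom_id, MonoidHom.id_apply]
  have hB : ∀ x : B.obj (op X.base), (B.map (baseMap φ).op).hom ((B.map (inv (baseMap φ)).op).hom x) = x := by
    intro x
    rw [← MonoidHom.comp_apply, ← CommMonCat.hom_comp, ← B.map_comp, ← op_comp, IsIso.hom_inv_id, op_id, B.map_id,
      CommMonCat.hom_id, MonoidHom.id_apply]
  apply Subtype.ext
  apply Aut.ext
  apply hom_ext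
  · rw [(unitsPull φ _).2.2, τ.2.2]
  · rw [(unitsPull φ _).2.1, τ.2.1]
  · rw [(unitsPull_hom_div_unit φ _).1]
    exact hΦ _
  · rw [(unitsPull_hom_div_unit φ _).2]
    exact hB _

end ModelFrobenioid

end Literature.AlgebraicGeometry.Frobenioids

namespace Literature.AnabelianGeometry.EtaleTheta

open CategoryTheory Opposite FrobenioidCyclotomicRigidity Literature.AlgebraicGeometry.Frobenioids

universe u₀ v₀ u v w w₁ v₁ v₁' u₁ u₁'

namespace ThetaFrobenioid

/-! ### Abstract §5 data: moving a unit of `A_N` across the root (the unit renormalisation of the Thm. 5.7 transport) -/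

section Renormalise

variable {C : Type u₁} [Category.{v₁} C] {D : Type u₁'} [Category.{v₁'} D] (𝔉 : ThetaFrobenioid.{w₁} C D)

/-- **Unit renormalisation of the normalised Thm. 5.7 transport** (Thm. 5.6 proof p.329 (PDF p.103): `γ₂ ∘ s′ = t′ ∘ γ₁`,
`u ∘ γ₂ ∘ s″ = t″ ∘ γ₁`; Thm. 5.10 (ii) p.334 (PDF p.108)): if `α⁻¹ Ψ(s^⊓_N) β = s^⊓_N` and `α⁻¹ Ψ(s^⊔_N) β = s^⊔_N ∘ D_p`, then for
any unit `u′ ∈ O^×(B_N)` with `u := (s^⊓_N)^* u′`, replacing `β` by `β ≫ u′` gives `α⁻¹ Ψ(s^⊓_N) (β ≫ u′) = u ≫ s^⊓_N` and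
`α⁻¹ Ψ(s^⊔_N) (β ≫ u′) = u ≫ s^⊔_N ≫ (u′⁻¹ ∘ D_p ∘ u′)` — by T56-L09d `UnitsPullSpec` and the law (U) `(s^⊓_N)^* = (s^⊔_N)^*`
(base-equivalent).  The new `β` has the SAME base arrow (`Base(u′) = id`).  [cite: MochizukiEtTh2009, Thm 5.6 proof p.329 (PDF p.103)] -/
theorem capCupTransport_renormalise_unit (hspec : Thm56Sub.UnitsPullSpec 𝔉)
    (hUb : 𝔉.unitsPull 𝔉.sCap = 𝔉.unitsPull 𝔉.sCup)
    {Ψ : C ≌ C} {α : Ψ.functor.obj 𝔉.AN ≅ 𝔉.AN} {β : Ψ.functor.obj 𝔉.BN ≅ 𝔉.BN} {Dp : Aut 𝔉.BN}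
    (hc : α.inv ≫ Ψ.functor.map 𝔉.sCap ≫ β.hom = 𝔉.sCap)
    (hp : α.inv ≫ Ψ.functor.map 𝔉.sCup ≫ β.hom = 𝔉.sCup ≫ Dp.hom) (u' : 𝔉.units 𝔉.BN) :
    α.inv ≫ Ψ.functor.map 𝔉.sCap ≫ (β ≪≫ (u' : Aut 𝔉.BN)).hom =
        ((𝔉.unitsPull 𝔉.sCap u' : 𝔉.units 𝔉.AN) : Aut 𝔉.AN).hom ≫ 𝔉.sCap ≫ (1 : Aut 𝔉.BN).hom ∧
      α.inv ≫ Ψ.functor.map 𝔉.sCup ≫ (β ≪≫ (u' : Aut 𝔉.BN)).hom =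
        ((𝔉.unitsPull 𝔉.sCap u' : 𝔉.units 𝔉.AN) : Aut 𝔉.AN).hom ≫ 𝔉.sCup ≫ ((u' : Aut 𝔉.BN) * Dp * (u' : Aut 𝔉.BN)⁻¹).hom := by
  have hcap : 𝔉.sCap ≫ ((u' : 𝔉.units 𝔉.BN) : Aut 𝔉.BN).hom =
      ((𝔉.unitsPull 𝔉.sCap u' : 𝔉.units 𝔉.AN) : Aut 𝔉.AN).hom ≫ 𝔉.sCap := hspec 𝔉.sCap 𝔉.isPreStep_sCap.1 u'
  have hcup : 𝔉.sCup ≫ ((u' : 𝔉.units 𝔉.BN) : Aut 𝔉.BN).hom =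
      ((𝔉.unitsPull 𝔉.sCap u' : 𝔉.units 𝔉.AN) : Aut 𝔉.AN).hom ≫ 𝔉.sCup := by
    rw [hUb]
    exact hspec 𝔉.sCup 𝔉.isPreStep_sCup.1 u'
  refine ⟨?_, ?_⟩
  · rw [Iso.trans_hom, ← Category.assoc (Ψ.functor.map 𝔉.sCap), ← Category.assoc, hc, hcap]
    change _ = _ ≫ _ ≫ 𝟙 _
    rw [Category.comp_id]
  · rw [Iso.trans_hom, ← Category.assoc (Ψ.functor.map 𝔉.sCup), ← Category.assoc, hp, Category.assoc,
      Aut.Aut_mul_def, Aut.Aut_mul_def, Aut.Aut_inv_def, Iso.trans_hom, Iso.trans_hom, Iso.symm_hom,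
      ← Category.assoc _ 𝔉.sCup, ← hcup, Category.assoc, Iso.hom_inv_id_assoc]

/-- The conjugate `u′ ∘ D_p ∘ u′⁻¹` of a unit by a unit is a unit. [cite: MochizukiEtTh2009, Thm 5.6 proof p.329 (PDF p.103)] -/
theorem conj_mem_units_of_mem {S : C} {Dp : Aut S} (hDp : Dp ∈ 𝔉.units S) (u' : 𝔉.units S) :
    (u' : Aut S) * Dp * (u' : Aut S)⁻¹ ∈ 𝔉.units S :=
  (𝔉.units S).mul_mem ((𝔉.units S).mul_mem u'.2 hDp) ((𝔉.units S).inv_mem u'.2)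

/-- Composing `β` with a unit does not change `Δ`-push (the base arrow is unchanged): the T56-L09c binder `haΨ` is insensitive
to the unit renormalisation.  [cite: MochizukiEtTh2009, Thm 5.6 proof p.329 (PDF p.103)] -/
theorem lDeltaModNMap_trans_unit {X : C} (β : X ≅ 𝔉.BN) (u' : 𝔉.units 𝔉.BN) (x : 𝔉.lDeltaModN X) :
    𝔉.lDeltaModNMap (β ≪≫ (u' : Aut 𝔉.BN)).hom x = 𝔉.lDeltaModNMap β.hom x := by
  apply Thm56Sub.lDeltaModNMap_congr_base
  rw [Iso.trans_hom, Functor.map_comp, 𝔉.base_map_units 𝔉.BN _ u'.2, Category.comp_id]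

end Renormalise

/-! ### At the genuine §5 data -/

section Data

variable {K : Type u₀} [Field K]
  {X : SemiGraphs.TemperedArithmeticGroup.{u₀} K} {D₀ : Type u₀} [Category.{v₀} D₀]
  {V : FrdIMonoidStub.{w}} {T₀ : RealifiedDivisorMonoids (D₀ := D₀) V} {D : Type u} [Category.{v} D]
  {VD : FrdICatStub.{u, v, w} D} {S : BiKummerSetting X T₀ D VD}
  {pullFrac : ∀ {A A' : S.C} (_ : A' ⟶ A), S.biratUnits A → S.biratUnits A'}
  {lv N : ℕ+} {l' : ℕ} {RD : RigidData.{max v w} N l'} {θ : S.biratUnits S.Aodot} {Bl : S.C}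
  {Pl : S.FractionPair θ Bl} {Rl : S.NthRoot θ Pl lv pullFrac}
  (h : ModelFrobenioid.Hypotheses S.tf.divisorMonoid S.tf.ratFnFunctor)
  (toB : ∀ A : S.C, S.biratUnits A →* S.tf.biratUnitsModel A) (Q : FrobenioidTheta.ThetaSubquotientStub.{w} D)
  (odd_l : Odd (lv : ℕ)) (R : S.NthRoot Rl.root Rl.pair N pullFrac) (ιX : RD.PiX ≃ₜ* X.Pi)
  (hopen : IsOpen ((S.galoisSurj R.AN.base R.αData.isGalois).ker : Set X.Pi)) (σ : Aut R.AN.base →* Aut R.AN)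
  (K' : Type w) [Field K'] (constEmb : K'ˣ →* S.tf.biratUnitsModel R.BN)
  (constEmb_injective : Function.Injective constEmb)
  (hdivc : ∀ g : Aut R.BN.base,
    ModelFrobenioid.div ((σ ((BiKummerSetting.NthRoot.baseIso S R).conjAut.symm g)).hom ≫ R.pair.num) =
      ModelFrobenioid.div R.pair.num)
  (hdivp : ∀ y : RD.PiYdd,
    ModelFrobenioid.div ((σ (S.galoisSurj R.AN.base R.αData.isGalois (ιX y.1))).hom ≫ R.pair.den) =
      ModelFrobenioid.div R.pair.den)

/-- `(s^⊓_N)^* : O^×(B_N) → O^×(A_N)` is ONTO for the assembled data (`Base(s^⊓_N)` is an isomorphism: pre-step).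
[cite: MochizukiEtTh2009, §5 p.331 (PDF p.105)] -/
theorem unitsPull_sCap_surjective_ofBiKummerData :
    Function.Surjective ((ofBiKummerData h toB Q odd_l R ιX hopen σ K' constEmb constEmb_injective hdivc hdivp).unitsPull (ofBiKummerData h toB Q odd_l R ιX hopen σ K' constEmb constEmb_injective hdivc hdivp).sCap) := by
  haveI : IsIso (ModelFrobenioid.baseMap R.pair.num) := (ofBiKummerData h toB Q odd_l R ιX hopen σ K' constEmb constEmb_injective hdivc hdivp).isPreStep_sCap.2
  exact ModelFrobenioid.unitsPull_surjective_of_isIso_baseMap R.pair.num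

/-- **The transports `hT`, `hT′`, `hu`, `hstrv` of Thm. 5.6 AT THE DATA with ONE unit `e` and the SAME base arrow for `β`**
(Thm. 5.10 (ii) proof p.334 (PDF p.108); Thm. 5.6 proof p.329 (PDF p.103)): from the NORMALISED Thm. 5.7 transport `(α, β, D_p)`
(`α⁻¹ Ψ(s^⊓_N) β = s^⊓_N`, `α⁻¹ Ψ(s^⊔_N) β = s^⊔_N ∘ D_p`, `D_p` a unit) and the [FrdI] Prop. 5.6 / Thm. 3.4 (iii) data at `A_N`
(abc-iut-w5-d245's `exists_unit_strvTransport_ofBiKummerData`): a unit `e ∈ O^×(A_N)`, a unit `u′ ∈ O^×(B_N)` and a unit `D_p′` with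
`hT[e, β ≫ u′]`, `hT′[e, β ≫ u′, D_p′]` and `StrvTransport Ψ α e θ_B`.  [cite: MochizukiEtTh2009, Thm 5.10 (ii) p.334 (PDF p.108)] -/
theorem exists_unit_transports_sameBase_ofBiKummerData
    (hσ : ∀ g : Aut R.AN.base, ModelFrobenioid.baseMap (σ g).hom = g.hom)
    (φ : ℕ+ →* End R.AN)
    (hφ : ∀ n : ℕ+, PreFrobenioid.degFr S.F (End.asHom (φ n)) = n ∧
      PreFrobenioid.IsBaseIdentity S.F (End.asHom (φ n)) ∧ PreFrobenioid.IsFrobeniusType S.F (End.asHom (φ n)))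
    (hc : ∀ (n : ℕ+) (g : Aut R.AN.base), (σ g).hom ≫ End.asHom (φ n) = End.asHom (φ n) ≫ (σ g).hom)
    (Ψ : S.C ≌ S.C) (α : Ψ.functor.obj (ofBiKummerData h toB Q odd_l R ιX hopen σ K' constEmb constEmb_injective hdivc hdivp).AN ≅ (ofBiKummerData h toB Q odd_l R ιX hopen σ K' constEmb constEmb_injective hdivc hdivp).AN) (β : Ψ.functor.obj (ofBiKummerData h toB Q odd_l R ιX hopen σ K' constEmb constEmb_injective hdivc hdivp).BN ≅ (ofBiKummerData h toB Q odd_l R ιX hopen σ K' constEmb constEmb_injective hdivc hdivp).BN)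
    (θ : Aut R.AN.base ≃* Aut R.AN.base)
    (hθ : ∀ f : Aut R.AN, (PreFrobenioid.baseFunctor S.F).mapIso (α.symm ≪≫ Ψ.functor.mapIso f ≪≫ α) =
      θ ((PreFrobenioid.baseFunctor S.F).mapIso f))
    (ΨN : ℕ+ ≃* ℕ+)
    (hdeg : ∀ f : R.AN ⟶ R.AN, PreFrobenioid.degFr S.F (α.inv ≫ Ψ.functor.map f ≫ α.hom) = ΨN (PreFrobenioid.degFr S.F f))
    (hbi : ∀ f : R.AN ⟶ R.AN, PreFrobenioid.IsBaseIdentity S.F f →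
      PreFrobenioid.IsBaseIdentity S.F (α.inv ≫ Ψ.functor.map f ≫ α.hom))
    (hft : ∀ f : R.AN ⟶ R.AN, PreFrobenioid.IsFrobeniusType S.F f →
      PreFrobenioid.IsFrobeniusType S.F (α.inv ≫ Ψ.functor.map f ≫ α.hom))
    {Dp₀ : Aut (ofBiKummerData h toB Q odd_l R ιX hopen σ K' constEmb constEmb_injective hdivc hdivp).BN} (hc₁ : α.inv ≫ Ψ.functor.map (ofBiKummerData h toB Q odd_l R ιX hopen σ K' constEmb constEmb_injective hdivc hdivp).sCap ≫ β.hom = (ofBiKummerData h toB Q odd_l R ιX hopen σ K' constEmb constEmb_injective hdivc hdivp).sCap)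
    (hp₁ : α.inv ≫ Ψ.functor.map (ofBiKummerData h toB Q odd_l R ιX hopen σ K' constEmb constEmb_injective hdivc hdivp).sCup ≫ β.hom = (ofBiKummerData h toB Q odd_l R ιX hopen σ K' constEmb constEmb_injective hdivc hdivp).sCup ≫ Dp₀.hom) (hDp₀ : Dp₀ ∈ (ofBiKummerData h toB Q odd_l R ιX hopen σ K' constEmb constEmb_injective hdivc hdivp).units (ofBiKummerData h toB Q odd_l R ιX hopen σ K' constEmb constEmb_injective hdivc hdivp).BN) :
    ∃ e ∈ (ofBiKummerData h toB Q odd_l R ιX hopen σ K' constEmb constEmb_injective hdivc hdivp).units (ofBiKummerData h toB Q odd_l R ιX hopen σ K' constEmb constEmb_injective hdivc hdivp).AN, ∃ u' : (ofBiKummerData h toB Q odd_l R ιX hopen σ K' constEmb constEmb_injective hdivc hdivp).units (ofBiKummerData h toB Q odd_l R ιX hopen σ K' constEmb constEmb_injective hdivc hdivp).BN, ∃ Dp ∈ (ofBiKummerData h toB Q odd_l R ιX hopen σ K' constEmb constEmb_injective hdivc hdivp).units (ofBiKummerData h toB Q odd_l R ιX hopen σ K' constEmb constEmb_injective hdivc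 hdivp).BN,
      α.inv ≫ Ψ.functor.map (ofBiKummerData h toB Q odd_l R ιX hopen σ K' constEmb constEmb_injective hdivc hdivp).sCap ≫ (β ≪≫ (u' : Aut (ofBiKummerData h toB Q odd_l R ιX hopen σ K' constEmb constEmb_injective hdivc hdivp).BN)).hom = e.hom ≫ (ofBiKummerData h toB Q odd_l R ιX hopen σ K' constEmb constEmb_injective hdivc hdivp).sCap ≫ (1 : Aut (ofBiKummerData h toB Q odd_l R ιX hopen σ K' constEmb constEmb_injective hdivc hdivp).BN).hom ∧
      α.inv ≫ Ψ.functor.map (ofBiKummerData h toB Q odd_l R ιX hopen σ K' constEmb constEmb_injective hdivc hdivp).sCup ≫ (β ≪≫ (u' : Aut (ofBiKummerData h toB Q odd_l R ιX hopen σ K' constEmb constEmb_injective hdivc hdivp).BN)).hom = e.hom ≫ (ofBiKummerData h toB Q odd_l R ιX hopen σ K' constEmb constEmb_injective hdivc hdivp).sCup ≫ Dp.hom ∧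
      (ofBiKummerData h toB Q odd_l R ιX hopen σ K' constEmb constEmb_injective hdivc hdivp).StrvTransport Ψ α e (((ofBiKummerData h toB Q odd_l R ιX hopen σ K' constEmb constEmb_injective hdivc hdivp).autBaseIsoAB.symm.trans θ).trans (ofBiKummerData h toB Q odd_l R ιX hopen σ K' constEmb constEmb_injective hdivc hdivp).autBaseIsoAB) := by
  obtain ⟨e, he, hstrv⟩ := exists_unit_strvTransport_ofBiKummerData h toB Q odd_l R ιX hopen σ K' constEmb constEmb_injective hdivc hdivp hσ φ hφ hc Ψ α θ hθ ΨN hdeg hbi hft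
  obtain ⟨u', hu'⟩ := unitsPull_sCap_surjective_ofBiKummerData h toB Q odd_l R ιX hopen σ K' constEmb constEmb_injective hdivc hdivp ⟨e, he⟩
  have hUb : (ofBiKummerData h toB Q odd_l R ιX hopen σ K' constEmb constEmb_injective hdivc hdivp).unitsPull (ofBiKummerData h toB Q odd_l R ιX hopen σ K' constEmb constEmb_injective hdivc hdivp).sCap = (ofBiKummerData h toB Q odd_l R ιX hopen σ K' constEmb constEmb_injective hdivc hdivp).unitsPull (ofBiKummerData h toB Q odd_l R ιX hopen σ K' constEmb constEmb_injective hdivc hdivp).sCup :=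
    unitsPullCongrBase_ofBiKummerData h toB Q odd_l R ιX hopen σ K' constEmb constEmb_injective hdivc hdivp _ _ (ofBiKummerData h toB Q odd_l R ιX hopen σ K' constEmb constEmb_injective hdivc hdivp).base_map_sCap
  have key := (ofBiKummerData h toB Q odd_l R ιX hopen σ K' constEmb constEmb_injective hdivc hdivp).capCupTransport_renormalise_unit (unitsPullSpec_ofBiKummerData h toB Q odd_l R ιX hopen σ K' constEmb constEmb_injective hdivc hdivp) hUb hc₁ hp₁ u'
  rw [hu'] at key
  exact ⟨e, he, u', (u' : Aut (ofBiKummerData h toB Q odd_l R ιX hopen σ K' constEmb constEmb_injective hdivc hdivp).BN) * Dp₀ * (u' : Aut (ofBiKummerData h toB Q odd_l R ιX hopen σ K' constEmb constEmb_injective hdivc hdivp).BN)⁻¹, (ofBiKummerData h toB Q odd_l R ιX hopen σ K' constEmb constEmb_injective hdivc hdivp).conj_mem_units_of_mem hDp₀ u', key.1, key.2, hstrv⟩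

/-- **[EtTh] Prop. 5.5 ⊕ Thm. 5.6 (i) AT THE GENUINE §5 DATA — ALL LANDED LEAVES PLUGGED**: for `𝔉 := ofBiKummerData …`, the
subquotient datum `P` and the theta-saturation `hB` of `B_N`, there is a UNIQUE rigidity family `ρ` that is Kummer-determined on
`B_N` through `P` and functorial for linear morphisms (Prop. 5.5), and every self-equivalence `Ψ` — with its base shadow and
`Δ`-transport data, its NORMALISED Thm. 5.7 transport `(α, β, D_p)` and its [FrdI] Prop. 5.6 / Thm. 3.4 (iii) data at `A_N` —
PRESERVES `ρ` (Thm. 5.6), modulo exactly the named residuals of the module docstring.  Composition: abc-iut-w4-d099's Prop. 5.5 at the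
data (leaf (G) := `hGalT`) with `hcup` := abc-iut-L6-t23's `hcup_iff_pull_root_mul … |>.mpr hKR` and `hconst` :=
abc-iut-w5-d020's `hconst_ofBiKummerData_of_cnst hP34 hΔcnst`; then abc-iut-w5-d020's Thm. 5.6 at the data with the transports
from `exists_unit_transports_sameBase_ofBiKummerData`, `hYdd` := abc-iut-w5-d245's `hYdd_ofBiKummerData_of_prop24`, `hdiff` :=
abc-iut-L2-t4's `biKummerDifferenceMem_ofBiKummerData`, and `haΨ` transported along the unit renormalisation of `β`.
[cite: MochizukiEtTh2009, Prop 5.5 p.327 (PDF p.101); Thm 5.6 p.328 (PDF p.102)] -/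
theorem exists_rigidityFamily_unique_preserved_ofBiKummerData_of_leaves
    -- Prop 5.5 side (η / ν pin, reachability, stub laws)
    (hB : (ofBiKummerData h toB Q odd_l R ιX hopen σ K' constEmb constEmb_injective hdivc hdivp).IsThetaSaturated (ofBiKummerData h toB Q odd_l R ιX hopen σ K' constEmb constEmb_injective hdivc hdivp).BN) (P : ThetaSubquotientProj (ofBiKummerData h toB Q odd_l R ιX hopen σ K' constEmb constEmb_injective hdivc hdivp))
    {η₀ : RD.PiYdd → RD.mu} (hη₀ : η₀ ∈ RD.thetaCocycles)
    (hdies : ∀ k : RD.PiYdd, rhoOfBiKummerData R ιX k = 1 → η₀ k = 1)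
    (e : RD.mu → (ofBiKummerData h toB Q odd_l R ιX hopen σ K' constEmb constEmb_injective hdivc hdivp).lDeltaModN (ofBiKummerData h toB Q odd_l R ιX hopen σ K' constEmb constEmb_injective hdivc hdivp).BN) (he : Function.Surjective e)
    (hpre : ∀ k : RD.PiYdd, (k : RD.PiX) ∈ RD.lDeltaTheta → rhoOfBiKummerData R ιX k ∈ P.pre _)
    (hP : ∀ (k : RD.PiYdd) (hk : (k : RD.PiX) ∈ RD.lDeltaTheta) (hm : rhoOfBiKummerData R ιX k ∈ P.pre _),
      (QuotientGroup.mk (P.proj _ ⟨rhoOfBiKummerData R ιX k, hm⟩) : (ofBiKummerData h toB Q odd_l R ιX hopen σ K' constEmb constEmb_injective hdivc hdivp).lDeltaModN (ofBiKummerData h toB Q odd_l R ιX hopen σ K' constEmb constEmb_injective hdivc hdivp).BN) = e (RD.thetaMod ⟨k, hk⟩))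
    (hcov' : ∀ g ∈ P.pre ((ofBiKummerData h toB Q odd_l R ιX hopen σ K' constEmb constEmb_injective hdivc hdivp).base.obj (ofBiKummerData h toB Q odd_l R ιX hopen σ K' constEmb constEmb_injective hdivc hdivp).BN), ∃ k : RD.PiYdd, (k : RD.PiX) ∈ RD.lDeltaTheta ∧ rhoOfBiKummerData R ιX k = g)
    (ν : (ofBiKummerData h toB Q odd_l R ιX hopen σ K' constEmb constEmb_injective hdivc hdivp).lDeltaModN (ofBiKummerData h toB Q odd_l R ιX hopen σ K' constEmb constEmb_injective hdivc hdivp).BN ≃* (ofBiKummerData h toB Q odd_l R ιX hopen σ K' constEmb constEmb_injective hdivc hdivp).muTorsion (ofBiKummerData h toB Q odd_l R ιX hopen σ K' constEmb constEmb_injective hdivc hdivp).BN (ofBiKummerData h toB Q odd_l R ιX hopen σ K' constEmb constEmb_injective hdivc hdivp).N)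
    (hKν : ∀ η : (ofBiKummerData h toB Q odd_l R ιX hopen σ K' constEmb constEmb_injective hdivc hdivp).HB → (ofBiKummerData h toB Q odd_l R ιX hopen σ K' constEmb constEmb_injective hdivc hdivp).lDeltaModN (ofBiKummerData h toB Q odd_l R ιX hopen σ K' constEmb constEmb_injective hdivc hdivp).BN,
      (∀ k : RD.PiYdd, η ⟨rhoOfBiKummerData R ιX k, Subgroup.mem_map_of_mem _ k.2⟩ = e (η₀ k)) →
        FrobenioidThetaBiKummer.ThetaPairKummerClass (ofBiKummerData h toB Q odd_l R ιX hopen σ K' constEmb constEmb_injective hdivc hdivp) η ν)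
    (hσ : ∀ g : Aut R.AN.base, ModelFrobenioid.baseMap (σ g).hom = g.hom)
    (hgeom : P.pre R.BN.base ≤ RD.aug.ker.map (rhoOfBiKummerData R ιX))
    -- T56-L09b: Prop 3.4 (ii) constants + the origin clause «cnst kills Ker aug» (G-w5d020-2)
    {Dcnst : Type u₁} [Category.{v₁} Dcnst] {cnst : D₀ ⥤ Dcnst} (hP34 : RealifiedDivisorMonoids.Prop34Cnst T₀ cnst)
    (hΔcnst : ∀ δ ∈ RD.aug.ker,
      cnst.map (S.tf.base.map (rhoOfBiKummerData R ιX δ).hom) = 𝟙 (cnst.obj (S.tf.base.obj R.BN.base)))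
    (hreach : LinearlyReachableFromBN (ofBiKummerData h toB Q odd_l R ιX hopen σ K' constEmb constEmb_injective hdivc hdivp))
    (hLc : Thm56Sub.LDeltaMapComp (ofBiKummerData h toB Q odd_l R ιX hopen σ K' constEmb constEmb_injective hdivc hdivp)) (hLi : Thm56Sub.LDeltaMapId (ofBiKummerData h toB Q odd_l R ιX hopen σ K' constEmb constEmb_injective hdivc hdivp))
    -- P55-L06 leaves: (G) as the base law, hproj named, hcup as the pull-root law of abc-iut-L6-t23
    (hGalT : ∀ ⦃A : D⦄, S.IsGaloisObj A → ∀ ⦃T : D⦄ (b b' : A ⟶ T), ∃ g : Aut A, b' = g.hom ≫ b)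
    (hproj : ∀ (g g' : Aut ((ofBiKummerData h toB Q odd_l R ιX hopen σ K' constEmb constEmb_injective hdivc hdivp).base.obj (ofBiKummerData h toB Q odd_l R ιX hopen σ K' constEmb constEmb_injective hdivc hdivp).BN)) (hh : g' ∈ P.pre _), ∃ hgh : g * g' * g⁻¹ ∈ P.pre _,
      (ofBiKummerData h toB Q odd_l R ιX hopen σ K' constEmb constEmb_injective hdivc hdivp).lDeltaMap g.hom (P.proj _ ⟨g', hh⟩) = P.proj _ ⟨g * g' * g⁻¹, hgh⟩)
    (hKR : ∀ (y₀ y : RD.PiX), y ∈ RD.PiYdd → rhoOfBiKummerData R ιX y ∈ P.pre R.BN.base →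
      pull S.tf.ratFnFunctor (S.galoisSurj R.AN.base R.αData.isGalois (ιX y)).hom
          (pull S.tf.ratFnFunctor (S.galoisSurj R.AN.base R.αData.isGalois (ιX y₀)).hom
            (toB R.AN R.root : S.tf.ratFnFunctor.obj (op R.AN.base))) *
          (toB R.AN R.root : S.tf.ratFnFunctor.obj (op R.AN.base)) =
        pull S.tf.ratFnFunctor (S.galoisSurj R.AN.base R.αData.isGalois (ιX y)).hom
            (toB R.AN R.root : S.tf.ratFnFunctor.obj (op R.AN.base)) *
          pull S.tf.ratFnFunctor (S.galoisSurj R.AN.base R.αData.isGalois (ιX y₀)).hom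
            (toB R.AN R.root : S.tf.ratFnFunctor.obj (op R.AN.base)))
    -- t4's inputs discharging hdiff ([FrdI] Prop 5.6 section law, Π^tp_Ÿ ⊆ H_⊙, Thm 5.2 (ii) dictionary)
    (hH : ∀ y : RD.PiX, y ∈ RD.PiYdd → ιX y ∈ S.Hodot)
    (hfrac : ∀ {A B : S.C} (s' s'' : A ⟶ B) (h' : S.IsPreStep s') (h'' : S.IsPreStep s'')
      (hb : PreFrobenioid.BaseEquivalent S.F s' s''),
      (toB A (S.fracOf s' s'' h' h'' hb) : S.tf.ratFnFunctor.obj (op A.base)) *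
        ModelFrobenioid.unit s'' = ModelFrobenioid.unit s')
    (haut : ∀ {A : S.C} (e : Aut A) (x : S.biratUnits A),
      (toB A (S.biratAut A e x) : S.tf.ratFnFunctor.obj (op A.base)) =
        pull S.tf.ratFnFunctor (ModelFrobenioid.baseMap e.inv) (toB A x : S.tf.ratFnFunctor.obj (op A.base)))
    -- Thm 5.6 side: Ψ, its base shadow, Δ-transport and μ-pull data (abc-iut-L2-d4)
    (Ψ : S.C ≌ S.C) (Ψbs : D ⥤ D) [Ψbs.Faithful] (eΨ : Ψ.functor ⋙ (ofBiKummerData h toB Q odd_l R ιX hopen σ K' constEmb constEmb_injective hdivc hdivp).base ≅ (ofBiKummerData h toB Q odd_l R ιX hopen σ K' constEmb constEmb_injective hdivc hdivp).base ⋙ Ψbs)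
    (aΨ : ∀ A : S.C, (ofBiKummerData h toB Q odd_l R ιX hopen σ K' constEmb constEmb_injective hdivc hdivp).lDeltaModN A ≃* (ofBiKummerData h toB Q odd_l R ιX hopen σ K' constEmb constEmb_injective hdivc hdivp).lDeltaModN (Ψ.functor.obj A))
    (hlin : PreFrobenioidData.PreservesMor Ψ.functor (ofBiKummerData h toB Q odd_l R ιX hopen σ K' constEmb constEmb_injective hdivc hdivp).IsLinear (ofBiKummerData h toB Q odd_l R ιX hopen σ K' constEmb constEmb_injective hdivc hdivp).IsLinear)
    (haΨn : ∀ {A A' : S.C} (φ : A ⟶ A') (x : (ofBiKummerData h toB Q odd_l R ιX hopen σ K' constEmb constEmb_injective hdivc hdivp).lDeltaModN A),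
      aΨ A' ((ofBiKummerData h toB Q odd_l R ιX hopen σ K' constEmb constEmb_injective hdivc hdivp).lDeltaModNMap φ x) = (ofBiKummerData h toB Q odd_l R ιX hopen σ K' constEmb constEmb_injective hdivc hdivp).lDeltaModNMap (Ψ.functor.map φ) (aΨ A x))
    (hpull : ∀ {A A' : S.C} (φ : A ⟶ A') (u : (ofBiKummerData h toB Q odd_l R ιX hopen σ K' constEmb constEmb_injective hdivc hdivp).muTorsion A' (ofBiKummerData h toB Q odd_l R ιX hopen σ K' constEmb constEmb_injective hdivc hdivp).N)
      (hu : Ψ.functor.mapAut A' (u : Aut A') ∈ (ofBiKummerData h toB Q odd_l R ιX hopen σ K' constEmb constEmb_injective hdivc hdivp).muTorsion (Ψ.functor.obj A') (ofBiKummerData h toB Q odd_l R ιX hopen σ K' constEmb constEmb_injective hdivc hdivp).N),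
      Ψ.functor.mapAut A ((ofBiKummerData h toB Q odd_l R ιX hopen σ K' constEmb constEmb_injective hdivc hdivp).muTorsionPull φ (ofBiKummerData h toB Q odd_l R ιX hopen σ K' constEmb constEmb_injective hdivc hdivp).N u : Aut A) = ((ofBiKummerData h toB Q odd_l R ιX hopen σ K' constEmb constEmb_injective hdivc hdivp).muTorsionPull (Ψ.functor.map φ) (ofBiKummerData h toB Q odd_l R ιX hopen σ K' constEmb constEmb_injective hdivc hdivp).N ⟨_, hu⟩ : Aut (Ψ.functor.obj A)))
    -- the NORMALISED Thm 5.7 transport (D_c = 1, e = 1: abc-iut-L2-d4 T1 + abc-iut-w5-d245 `capCupTransport_normalise`)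
    (α : Ψ.functor.obj (ofBiKummerData h toB Q odd_l R ιX hopen σ K' constEmb constEmb_injective hdivc hdivp).AN ≅ (ofBiKummerData h toB Q odd_l R ιX hopen σ K' constEmb constEmb_injective hdivc hdivp).AN) (β : Ψ.functor.obj (ofBiKummerData h toB Q odd_l R ιX hopen σ K' constEmb constEmb_injective hdivc hdivp).BN ≅ (ofBiKummerData h toB Q odd_l R ιX hopen σ K' constEmb constEmb_injective hdivc hdivp).BN) {Dp₀ : Aut (ofBiKummerData h toB Q odd_l R ιX hopen σ K' constEmb constEmb_injective hdivc hdivp).BN}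
    (hc₁ : α.inv ≫ Ψ.functor.map (ofBiKummerData h toB Q odd_l R ιX hopen σ K' constEmb constEmb_injective hdivc hdivp).sCap ≫ β.hom = (ofBiKummerData h toB Q odd_l R ιX hopen σ K' constEmb constEmb_injective hdivc hdivp).sCap)
    (hp₁ : α.inv ≫ Ψ.functor.map (ofBiKummerData h toB Q odd_l R ιX hopen σ K' constEmb constEmb_injective hdivc hdivp).sCup ≫ β.hom = (ofBiKummerData h toB Q odd_l R ιX hopen σ K' constEmb constEmb_injective hdivc hdivp).sCup ≫ Dp₀.hom) (hDp₀ : Dp₀ ∈ (ofBiKummerData h toB Q odd_l R ιX hopen σ K' constEmb constEmb_injective hdivc hdivp).units (ofBiKummerData h toB Q odd_l R ιX hopen σ K' constEmb constEmb_injective hdivc hdivp).BN)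
    -- [FrdI] Prop 5.6 / Thm 3.4 (iii) data at A_N (abc-iut-w5-d245's Prop 5.6 unit)
    (φ : ℕ+ →* End R.AN)
    (hφ : ∀ n : ℕ+, PreFrobenioid.degFr S.F (End.asHom (φ n)) = n ∧
      PreFrobenioid.IsBaseIdentity S.F (End.asHom (φ n)) ∧ PreFrobenioid.IsFrobeniusType S.F (End.asHom (φ n)))
    (hc : ∀ (n : ℕ+) (g : Aut R.AN.base), (σ g).hom ≫ End.asHom (φ n) = End.asHom (φ n) ≫ (σ g).hom)
    (θA : Aut R.AN.base ≃* Aut R.AN.base)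
    (hθ : ∀ f : Aut R.AN, (PreFrobenioid.baseFunctor S.F).mapIso (α.symm ≪≫ Ψ.functor.mapIso f ≪≫ α) =
      θA ((PreFrobenioid.baseFunctor S.F).mapIso f))
    (ΨN : ℕ+ ≃* ℕ+)
    (hdeg : ∀ f : R.AN ⟶ R.AN, PreFrobenioid.degFr S.F (α.inv ≫ Ψ.functor.map f ≫ α.hom) = ΨN (PreFrobenioid.degFr S.F f))
    (hbi : ∀ f : R.AN ⟶ R.AN, PreFrobenioid.IsBaseIdentity S.F f →
      PreFrobenioid.IsBaseIdentity S.F (α.inv ≫ Ψ.functor.map f ≫ α.hom))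
    (hft : ∀ f : R.AN ⟶ R.AN, PreFrobenioid.IsFrobeniusType S.F f →
      PreFrobenioid.IsFrobeniusType S.F (α.inv ≫ Ψ.functor.map f ≫ α.hom))
    -- Prop 2.4 for the Galois shadow of θ_B (abc-iut-w5-d245's hYdd reduction) and T56-L09c
    (γ : RD.PiX ≃ₜ* RD.PiX)
    (hγ : ∀ y : RD.PiX, (((ofBiKummerData h toB Q odd_l R ιX hopen σ K' constEmb constEmb_injective hdivc hdivp).autBaseIsoAB.symm.trans θA).trans (ofBiKummerData h toB Q odd_l R ιX hopen σ K' constEmb constEmb_injective hdivc hdivp).autBaseIsoAB) (rhoOfBiKummerData R ιX y) =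
      rhoOfBiKummerData R ιX (γ y))
    (hP24 : RD.PiYdd.map γ.toMulEquiv.toMonoidHom = RD.PiYdd)
    (hγL : RD.lDeltaTheta.map γ.toMulEquiv.toMonoidHom = RD.lDeltaTheta)
    (haΨ : ∀ (k : RD.PiYdd) (hk : (k : RD.PiX) ∈ RD.lDeltaTheta) (hk' : γ k ∈ RD.lDeltaTheta),
      (ofBiKummerData h toB Q odd_l R ιX hopen σ K' constEmb constEmb_injective hdivc hdivp).lDeltaModNMap β.hom (aΨ _ (e (RD.thetaMod ⟨k, hk⟩))) = e (RD.thetaMod ⟨γ k, hk'⟩)) :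
    ∃ ρ : RigidityFamily (ofBiKummerData h toB Q odd_l R ιX hopen σ K' constEmb constEmb_injective hdivc hdivp), IsKummerDetermined (ofBiKummerData h toB Q odd_l R ιX hopen σ K' constEmb constEmb_injective hdivc hdivp) P ρ hB ∧ IsFunctorialLinear (ofBiKummerData h toB Q odd_l R ιX hopen σ K' constEmb constEmb_injective hdivc hdivp) ρ ∧
      (∀ ρ' : RigidityFamily (ofBiKummerData h toB Q odd_l R ιX hopen σ K' constEmb constEmb_injective hdivc hdivp), IsKummerDetermined (ofBiKummerData h toB Q odd_l R ιX hopen σ K' constEmb constEmb_injective hdivc hdivp) P ρ' hB → IsFunctorialLinear (ofBiKummerData h toB Q odd_l R ιX hopen σ K' constEmb constEmb_injective hdivc hdivp) ρ' → ρ' = ρ) ∧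
      CyclotomicRigidityPreserved (ofBiKummerData h toB Q odd_l R ιX hopen σ K' constEmb constEmb_injective hdivc hdivp) Ψ ρ aΨ := by
  -- T56-L09b: the units are constants (Prop 3.4 (ii)), geometric automorphisms die in `D^cnst`
  have hconst := hconst_ofBiKummerData_of_cnst (T := RD.toThetaEnvData) h R ιX hP34 hΔcnst
  -- P55-L06c: the `s^⊔-gp` conjugation law from the pull-root law (abc-iut-L6-t23)
  have hcup := (hcup_iff_pull_root_mul h toB Q odd_l R ιX hopen σ K' constEmb constEmb_injective hdivc hdivp hσ hfrac P).mpr hKR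
  -- Prop 5.5 at the data, leaf (G) := hGalT (abc-iut-w4-d099)
  obtain ⟨⟨ρ, hK, hρ⟩, huniq⟩ := cyclotomicRigidity_ofBiKummerData_of_galoisHomTorsor h toB Q odd_l R ιX hopen σ K' constEmb constEmb_injective hdivc hdivp hB P hη₀ hdies e he
    (fun a _ ha => hcov' a ha) hpre hP ν hKν hσ hgeom hconst hreach hLc hLi hGalT hproj hcup
  refine ⟨ρ, hK, hρ, fun ρ' hK' hρ' => (huniq ρ ρ' hK hρ hK' hρ').symm, ?_⟩
  -- the transports with ONE unit and the same base arrow for β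
  obtain ⟨eA, -, u', Dp, hDp, hT, hT', hstrv⟩ := exists_unit_transports_sameBase_ofBiKummerData h toB Q odd_l R ιX hopen σ K' constEmb constEmb_injective hdivc hdivp hσ φ hφ hc Ψ α β θA
    hθ ΨN hdeg hbi hft hc₁ hp₁ hDp₀
  -- T56-L09c binder transported along the unit renormalisation of β (same base arrow)
  have haΨ' : ∀ (k : RD.PiYdd) (hk : (k : RD.PiX) ∈ RD.lDeltaTheta) (hk' : γ k ∈ RD.lDeltaTheta),
      (ofBiKummerData h toB Q odd_l R ιX hopen σ K' constEmb constEmb_injective hdivc hdivp).lDeltaModNMap (β ≪≫ (u' : Aut (ofBiKummerData h toB Q odd_l R ιX hopen σ K' constEmb constEmb_injective hdivc hdivp).BN)).hom (aΨ _ (e (RD.thetaMod ⟨k, hk⟩))) = e (RD.thetaMod ⟨γ k, hk'⟩) :=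
    fun k hk hk' => ((ofBiKummerData h toB Q odd_l R ιX hopen σ K' constEmb constEmb_injective hdivc hdivp).lDeltaModNMap_trans_unit β u' _).trans (haΨ k hk hk')
  exact cyclotomicRigidityPreserved_ofBiKummerData h toB Q odd_l R ιX hopen σ K' constEmb constEmb_injective hdivc hdivp Ψ Ψbs eΨ α (β ≪≫ (u' : Aut (ofBiKummerData h toB Q odd_l R ιX hopen σ K' constEmb constEmb_injective hdivc hdivp).BN)) eA Dp
    (((ofBiKummerData h toB Q odd_l R ιX hopen σ K' constEmb constEmb_injective hdivc hdivp).autBaseIsoAB.symm.trans θA).trans (ofBiKummerData h toB Q odd_l R ιX hopen σ K' constEmb constEmb_injective hdivc hdivp).autBaseIsoAB) aΨ hlin haΨn hpull hreach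
    (biKummerDifferenceMem_ofBiKummerData h toB Q odd_l R ιX hopen σ K' constEmb constEmb_injective hdivc hdivp hσ hH hfrac haut)
    hT hT' hDp hstrv (hYdd_ofBiKummerData_of_prop24 h toB Q odd_l R ιX hopen σ K' constEmb constEmb_injective hdivc hdivp _ γ hγ hP24) P hσ hgeom hconst e he hpre hP hcov' γ hγ hγL haΨ'
    ρ hB hK hρ

end Data

end ThetaFrobenioid

end Literature.AnabelianGeometry.EtaleTheta

end
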